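import Summits.BirchSwinnertonDyer.BirchSwinnertonDyer.Theorems.TwoAdicConverseFullTwoTorsionRamifiedUnique
import HarnessLib

/-!
# Line `star` on crux E1M (stmt-BirchSwinnertonDyer-20341), even-index residue `stub_starOptBSFEven`: the CENTRE FLIP LEMMA (structure item (E2))

Lead star-p1 GEN 15.  Numerically (Cremona, odd squarefree N < 5·10⁵; memo Cruxes/DepletedLambdaLawAtTwoMod/Lines/star-sf-residue-gen15.md) every
habitat class with EVEN Shimura index at composite level has its `X₀(N)`-optimal curve `W₀` equal to the full-2-torsion CENTRE of the 2-isogeny tree,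
2-isogenous to the habitat curve.  In that configuration the conclusion of `stub_starOptBSFEven` — «`W₀` has a rational 2-torsion abscissa that is
ODD and NOT ramified at 2» — is PURE COMBINATORICS of Greenberg's flip laws along a 2-isogeny («kernel formal ⟺ dual kernel étale», «kernel odd ⟺
dual kernel even», tree `Greenberg1999.ramified_odd_dual_of_twoIsogeny_of_goodOrd_or_mult`, packaged in `Walk.twoIsogenyStep`) and of the two
uniqueness facts «at most one rational 2-torsion abscissa is ramified», «at most one is odd».  This file proves that combinatorial step in FLIP FORM
(the dual point `s'` on the partner `W'` is only constrained through the two flip equivalences, so any producer of the 2-isogeny — `Walk.twoIsogenyStep`,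
an explicit normal form — can feed it):

* `exists_odd_etale_of_flip_of_habitat` — `W` good at 2 with three distinct rational 2-torsion abscissas, `s` one of its rational 2-torsion
  abscissas, `(W', s')` any pair with `ram s ↔ ¬ ram s'`, `odd_W s ↔ ¬ odd_{W'} s'`, and `s'` of Greenberg type A xor B on `W'` ⇒ `W` has a rational
  2-torsion abscissa that is odd and not ramified.
* `exists_odd_etale_of_flip_of_typeA` — the type-A branch needs no full 2-torsion: `s` itself is the odd étale point.

What remains of the even-index residue after this is arithmetic: (E1) «even Shimura index at composite squarefree level ⇒ `W₀` has full rational 2-torsion and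
is 2-isogenous to the habitat curve» and (E3) the `T6/T8` corner (`N ≠ 15`).  Bookkeeping for an OPEN aside stub; nothing here reads `r_an`;
StarOptB / E1M / BSD are NOT proved by this file.
-/

set_option linter.dupNamespace false
set_option autoImplicit false

noncomputable section

open scoped Classical
open WeierstrassCurve Literature.NumberTheory.EllipticCurves Literature.NumberTheory.EllipticCurves.Greenberg1999
open Summit.BirchSwinnertonDyer.BirchSwinnertonDyer.Theorems.TwoAdicTwistConverse

namespace Summit.BirchSwinnertonDyer.BirchSwinnertonDyer.Theorems.DepletionAtTwo.SfCentreFlip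

variable (W : WeierstrassCurve ℚ)

/-- **Type-A branch of the centre flip lemma (no full 2-torsion needed).**  If the dual point `s'` on the partner `W'` is of Greenberg type A
(ramified at 2 and not odd) and the flip laws hold between `(W, s)` and `(W', s')`, then `s` is odd and not ramified on `W`: the sought point is `s`
itself. [cite: GreenbergLNM1716, §5 Props. 5.13–5.14 (pp. 120–121)] -/
theorem exists_odd_etale_of_flip_of_typeA {s : ℚ} (hs : HasRationalTwoTorsionX W s) {W' : WeierstrassCurve ℚ} {s' : ℚ}
    (hR : TwoTorsionRamifiedAtTwo s ↔ ¬ TwoTorsionRamifiedAtTwo s') (hO : TwoTorsionOdd W s ↔ ¬ TwoTorsionOdd W' s')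
    (hA : TwoTorsionRamifiedAtTwo s' ∧ ¬ TwoTorsionOdd W' s') :
    ∃ x₀ : ℚ, HasRationalTwoTorsionX W x₀ ∧ TwoTorsionOdd W x₀ ∧ ¬ TwoTorsionRamifiedAtTwo x₀ :=
  ⟨s, hs, hO.mpr hA.2, fun h ↦ hR.mp h hA.1⟩

/-- **THE CENTRE FLIP LEMMA.**  `W/ℚ` globally minimal with good reduction at 2 and THREE distinct rational 2-torsion abscissas `x₁, x₂, x₃`;
`s` a rational 2-torsion abscissa of `W`; `(W', s')` any pair satisfying the flip laws `ram s ↔ ¬ ram s'`, `odd_W s ↔ ¬ odd_{W'} s'` (e.g. the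
2-isogenous partner through `s` and its dual point, `Walk.twoIsogenyStep`); `s'` of Greenberg type A xor B on `W'` (the habitat hypothesis on the
neighbour).  Then `W` has a rational 2-torsion abscissa that is ODD and NOT ramified at 2.  Proof: type A ⇒ `s` itself (`exists_odd_etale_of_flip_of_typeA`);
type B ⇒ `s` is ramified and even, the odd abscissa `c` among `x₁, x₂, x₃` (`twoTorsionOdd_or_of_fullTwoTorsion`) is then `≠ s`, hence not ramified
(`not_twoTorsionRamifiedAtTwo_and` via `eq_of_twoTorsionRamifiedAtTwo_of_fullTwoTorsion`: at most one rational abscissa is ramified).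
[cite: GreenbergLNM1716, §5 Props. 5.13–5.14 and Remark (pp. 120–121)] [cite: SilvermanAEC2009, VII.2.2] -/
theorem exists_odd_etale_of_flip_of_habitat [W.IsGloballyMinimal] {x₁ x₂ x₃ : ℚ}
    (h12 : x₁ ≠ x₂) (h13 : x₁ ≠ x₃) (h23 : x₂ ≠ x₃) (h₁ : HasRationalTwoTorsionX W x₁)
    (h₂ : HasRationalTwoTorsionX W x₂) (h₃ : HasRationalTwoTorsionX W x₃)
    {s : ℚ} (hs : HasRationalTwoTorsionX W s) {W' : WeierstrassCurve ℚ} {s' : ℚ}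
    (hR : TwoTorsionRamifiedAtTwo s ↔ ¬ TwoTorsionRamifiedAtTwo s') (hO : TwoTorsionOdd W s ↔ ¬ TwoTorsionOdd W' s')
    (htype : (TwoTorsionRamifiedAtTwo s' ∧ ¬ TwoTorsionOdd W' s') ∨ (TwoTorsionOdd W' s' ∧ ¬ TwoTorsionRamifiedAtTwo s')) :
    ∃ x₀ : ℚ, HasRationalTwoTorsionX W x₀ ∧ TwoTorsionOdd W x₀ ∧ ¬ TwoTorsionRamifiedAtTwo x₀ := by
  rcases htype with hA | ⟨hOs', hRs'⟩
  · exact exists_odd_etale_of_flip_of_typeA W hs hR hO hA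
  · -- type B on the partner: `s` is ramified and even on `W`
    have hRs : TwoTorsionRamifiedAtTwo s := by
      by_contra h
      exact hRs' (by rwa [hR, not_not] at h)
    have hOs : ¬ TwoTorsionOdd W s := fun h ↦ hO.mp h hOs'
    -- the odd abscissa among the three
    obtain ⟨c, hc, hOc⟩ : ∃ c, HasRationalTwoTorsionX W c ∧ TwoTorsionOdd W c := by
      rcases twoTorsionOdd_or_of_fullTwoTorsion W h12 h13 h23 h₁ h₂ h₃ with h | h | h
      exacts [⟨x₁, h₁, h⟩, ⟨x₂, h₂, h⟩, ⟨x₃, h₃, h⟩]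
    refine ⟨c, hc, hOc, fun hRc ↦ hOs ?_⟩
    -- two ramified rational abscissas coincide, so `s = c` would be odd
    have hsc : s = c := eq_of_twoTorsionRamifiedAtTwo_of_fullTwoTorsion W h12 h13 h23 h₁ h₂ h₃ hs hRs hc hRc
    rw [hsc]
    exact hOc

/-- **The centre flip lemma with the partner produced by a 2-ISOGENY STEP.**  Same, with the flip laws packaged as the single conjunction delivered
by `Walk.twoIsogenyStep` under «good ordinary or multiplicative at 2 on both sides». [cite: GreenbergLNM1716, §5 Props. 5.13–5.14 (pp. 120–121)] -/
theorem exists_odd_etale_of_flips_of_habitat [W.IsGloballyMinimal] {x₁ x₂ x₃ : ℚ}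
    (h12 : x₁ ≠ x₂) (h13 : x₁ ≠ x₃) (h23 : x₂ ≠ x₃) (h₁ : HasRationalTwoTorsionX W x₁)
    (h₂ : HasRationalTwoTorsionX W x₂) (h₃ : HasRationalTwoTorsionX W x₃)
    {s : ℚ} (hs : HasRationalTwoTorsionX W s) {W' : WeierstrassCurve ℚ} {s' : ℚ}
    (hflip : (TwoTorsionRamifiedAtTwo s ↔ ¬ TwoTorsionRamifiedAtTwo s') ∧ (TwoTorsionOdd W s ↔ ¬ TwoTorsionOdd W' s'))
    (htype : (TwoTorsionRamifiedAtTwo s' ∧ ¬ TwoTorsionOdd W' s') ∨ (TwoTorsionOdd W' s' ∧ ¬ TwoTorsionRamifiedAtTwo s')) :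
    ∃ x₀ : ℚ, HasRationalTwoTorsionX W x₀ ∧ TwoTorsionOdd W x₀ ∧ ¬ TwoTorsionRamifiedAtTwo x₀ :=
  exists_odd_etale_of_flip_of_habitat W h12 h13 h23 h₁ h₂ h₃ hs hflip.1 hflip.2 htype

/-- **Contrapositive reading (the MID-pointed centre is never next to a habitat curve).**  If `W` (globally minimal, three rational 2-torsion
abscissas) has a rational abscissa `s` that is BOTH ramified and odd, then no flip-partner `(W', s')` of any rational abscissa `t` of `W` is of type
A xor B — i.e. all 2-neighbours of a MID-pointed centre are off habitat (the `N = 15` configuration: `15a1`).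
[cite: GreenbergLNM1716, §5 Props. 5.13–5.14 (pp. 120–121)] -/
theorem not_habitat_partner_of_ramified_odd [W.IsGloballyMinimal] {x₁ x₂ x₃ : ℚ}
    (h12 : x₁ ≠ x₂) (h13 : x₁ ≠ x₃) (h23 : x₂ ≠ x₃) (h₁ : HasRationalTwoTorsionX W x₁)
    (h₂ : HasRationalTwoTorsionX W x₂) (h₃ : HasRationalTwoTorsionX W x₃)
    {m : ℚ} (hm : HasRationalTwoTorsionX W m) (hRm : TwoTorsionRamifiedAtTwo m) (hOm : TwoTorsionOdd W m)
    {t : ℚ} (ht : HasRationalTwoTorsionX W t) {W' : WeierstrassCurve ℚ} {t' : ℚ}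
    (hR : TwoTorsionRamifiedAtTwo t ↔ ¬ TwoTorsionRamifiedAtTwo t') (hO : TwoTorsionOdd W t ↔ ¬ TwoTorsionOdd W' t') :
    ¬ ((TwoTorsionRamifiedAtTwo t' ∧ ¬ TwoTorsionOdd W' t') ∨ (TwoTorsionOdd W' t' ∧ ¬ TwoTorsionRamifiedAtTwo t')) := by
  intro htype
  obtain ⟨x₀, hx₀, hOx₀, hRx₀⟩ := exists_odd_etale_of_flip_of_habitat W h12 h13 h23 h₁ h₂ h₃ ht hR hO htype
  -- the odd abscissa is unique, so `x₀ = m` is ramified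
  have : x₀ = m := twoTorsionOdd_unique W hx₀ hm hOx₀ hOm
  exact hRx₀ (this ▸ hRm)

end Summit.BirchSwinnertonDyer.BirchSwinnertonDyer.Theorems.DepletionAtTwo.SfCentreFlip

end
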